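import Summits.KontsevichZagierPeriods.KontsevichZagierPeriods.Theorems.UnfoldedStokesStokesGenerationStubAngTransport
import Summits.KontsevichZagierPeriods.KontsevichZagierPeriods.Theorems.UnfoldedStokesStokesGenerationFibrewiseClosureMulFresh

/-!
# `StokesGeneration` (stmt-KontsevichZagierPeriods-3586) — line `fibrewise_stokes`, stub `stub_saSwapTransport`

Registered stub X9 (rung 10, the dlog-swap sector for semialgebraic units) of the line `fibrewise_stokes`
of the crux `StokesGeneration` (route UnfoldedStokes): **the closed-form transport, on the 4-cube `[0,1]⁴`
(coordinates `x₀, x₁`, homotopy variable `y = x₂`, silent `x₃`), of the transposition relator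
`γ (p′(x₀)/p(x₀) − q′(x₁)/q(x₁))`**, for real functions `p, q`, `ℚ`-semialgebraic (read on the interval
coordinate), positive and continuous on `[0,1]`, differentiable on `(0,1)` with derivatives `p′, q′`
(continuous on `[0,1]` and `ℚ`-semialgebraic), and a real algebraic `γ`. This is the landed polynomial
transport `stub_swapTransport` (rung 6) verbatim, with the semialgebraicity and continuity of
`p, q, p′, q′` now hypotheses and the derivatives used at interior fibre points only.

With `ρ = p(x₀)/q(x₁) > 0` and the straight-line homotopy `ρ_y = 1 + y (ρ − 1) = N/q(x₁)`,
`N = (1 − y) q(x₁) + y p(x₀) > 0` (a convex combination of positives), the closed `1`-form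
`d log ρ_y = a₀ dx₀ + a₁ dx₁ + b dy` has `a₀ + a₁ = (y p′(x₀) + (1 − y) q′(x₁))/N − q′(x₁)/q(x₁)` and
`b = (p(x₀) − q(x₁))/N`. Three fibrewise primitives, in the directions `![2, 0, 1]`:
* `G₀ = γ (y p′/p + (1 − y) q′/q − (y p′ + (1 − y) q′)/N)` along `y`, fibre derivative
  `D₀ = γ (p′/p − q′/q − (p′ q − q′ p)/N²)`; BOTH boundary values vanish (`N|_{y=1} = p(x₀)`, `N|_{y=0} = q(x₁)`);
* `G₁ = γ b = γ (p − q)/N` along `x₀`, `D₁ = γ p′ q/N²`, boundary values `γ (p(c) − q(x₁))/((1 − y) q(x₁) + y p(c))`;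
* `G₂ = γ b` along `x₁`, `D₂ = −γ q′ p/N²`, boundary values `γ (p(x₀) − q(c))/((1 − y) q(c) + y p(x₀))` (`c = 1, 0`).
Since `D₀ + D₁ + D₂ = γ (p′/p − q′/q)`, the relator is the sum of the three fibrewise Stokes elements
`Dⱼ − (Gⱼ|₁ − Gⱼ|₀)` plus the four boundary leftovers, recorded in the ratio form
`(p(1)/q(x₁) − 1)/(1 + y (p(1)/q(x₁) − 1)) = (p(1) − q(x₁))/((1 − y) q(x₁) + y p(1))`, etc. All data are
rational expressions, with denominators `N, p(x₀), q(x₁) > 0` on the cube, in the coordinates, in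
`p, q, p′, q′` read on one coordinate, and in the constants `γ, p(0), p(1), q(0), q(1)` (real-algebraic as
values of `ℚ`-semialgebraic functions at rational points, Kontsevich–Zagier §1.1): `ℚ`-semialgebraic
(Bochnak–Coste–Roy, Prop. 2.2.6) and continuous on the compact cube, hence bounded and integrable; there
is no kink set.

References: M. Kontsevich, D. Zagier, *Periods* (2001), §1.1–1.2; J. Ayoub, *Une version relative de la
conjecture des périodes de Kontsevich–Zagier*, Ann. of Math. 181 (2015), Rem. 1.5; J. Bochnak, M. Coste,
M.-F. Roy, *Real Algebraic Geometry* (1998), Prop. 2.2.6.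
-/

noncomputable section

-- `Summit.KontsevichZagierPeriods.KontsevichZagierPeriods.…` is the tree's mandated layout (single-conjunct summit).
set_option linter.dupNamespace false

namespace Summit.KontsevichZagierPeriods.KontsevichZagierPeriods.Cruxes.StokesGeneration.FibrewiseStokes

open MeasureTheory Set
open Literature.NumberTheory.Transcendental
open Literature.NumberTheory.Transcendental.KZ
open Literature.ModelTheory.ExponentialFields (IsSemialgebraic)

/-! ## Reading a semialgebraic function of the interval on one coordinate of a cube -/

/-- A function of one variable, `ℚ`-semialgebraic (read on the interval coordinate) and continuous on
`[0,1]`, read on the coordinate `i` of the cube `[0,1]ⁿ`, is `ℚ`-semialgebraic and continuous there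
(coordinate preimage of the graph). [cite: BochnakCosteRoy1998, Prop. 2.2.6] -/
theorem saSwapTrSC_coord {n : ℕ} {g : ℝ → ℝ}
    (hg : IsSemialgebraicFunOn ℚ (Set.pi Set.univ (fun _ : Fin 1 => Set.Icc (0:ℝ) 1)) (fun z => g (z 0)))
    (hgc : ContinuousOn g (Set.Icc (0:ℝ) 1)) (i : Fin n) :
    IsSemialgebraicFunOn ℚ (Set.pi Set.univ (fun _ : Fin n => Set.Icc (0:ℝ) 1)) (fun x => g (x i)) ∧
      ContinuousOn (fun x => g (x i)) (Set.pi Set.univ (fun _ : Fin n => Set.Icc (0:ℝ) 1)) := by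
  have hS : IsSemialgebraic ℚ (Set.pi Set.univ (fun _ : Fin n => Set.Icc (0:ℝ) 1)) := by
    rw [← cube_eq_pi]; exact isSemialgebraic_cube
  refine ⟨?_, hgc.comp (continuous_apply i).continuousOn fun x hx => hx i (Set.mem_univ _)⟩
  refine (isSemialgebraicFunOn_comp_coord hg (fun _ : Fin 1 => i)).mono (fun y hy => ?_) hS
  simp only [Set.mem_setOf_eq, Set.mem_univ_pi]
  exact fun _ => hy i (Set.mem_univ _)

/-- The value at an algebraic point of `[0,1]` of a function `ℚ`-semialgebraic on the unit interval (read
on the interval coordinate) is real-algebraic, hence a `ℚ`-semialgebraic (and continuous) constant on any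
`ℚ`-semialgebraic set. [cite: KontsevichZagier2001, §1.1] -/
theorem saSwapTrSC_value {n : ℕ} {S : Set (Fin n → ℝ)} (hS : IsSemialgebraic ℚ S) {g : ℝ → ℝ}
    (hg : IsSemialgebraicFunOn ℚ (Set.pi Set.univ (fun _ : Fin 1 => Set.Icc (0:ℝ) 1)) (fun z => g (z 0)))
    {c : ℝ} (hc : c ∈ Set.Icc (0:ℝ) 1) (hca : IsAlgebraic ℚ c) :
    IsSemialgebraicFunOn ℚ S (fun _ => g c) ∧ ContinuousOn (fun _ => g c) S :=
  angTrSC_const hS (hg.isAlgebraic_apply (a := fun _ => c) (fun _ _ => hc) fun _ => hca)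

/-! ## Calculus of the primitives `G₁ = G₂` along their fibres -/

/-- Direction `x₀`: `d/du [γ (p(u) − Q)/((1 − y) Q + y p(u))] = γ p′(u) Q/((1 − y) Q + y p(u))²` at a point
where `p` is differentiable and the denominator does not vanish (quotient rule). [folklore] -/
theorem saSwapTr_hasDerivAt_dir0 {p : ℝ → ℝ} {e γ Q y s : ℝ} (hp : HasDerivAt p e s)
    (hN : (1 - y) * Q + y * p s ≠ 0) :
    HasDerivAt (fun u : ℝ => γ * (p u - Q) / ((1 - y) * Q + y * p u))
      (γ * e * Q / ((1 - y) * Q + y * p s) ^ 2) s := by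
  refine (((hp.sub_const Q).const_mul γ).fun_div ((hp.const_mul y).const_add ((1 - y) * Q)) hN).congr_deriv ?_
  ring

/-- Direction `x₁`: `d/du [γ (P − q(u))/((1 − y) q(u) + y P)] = −γ q′(u) P/((1 − y) q(u) + y P)²` at a point
where `q` is differentiable and the denominator does not vanish (quotient rule). [folklore] -/
theorem saSwapTr_hasDerivAt_dir1 {q : ℝ → ℝ} {e γ P y s : ℝ} (hq : HasDerivAt q e s)
    (hN : (1 - y) * q s + y * P ≠ 0) :
    HasDerivAt (fun u : ℝ => γ * (P - q u) / ((1 - y) * q u + y * P))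
      (-(γ * e * P) / ((1 - y) * q s + y * P) ^ 2) s := by
  refine (((hq.const_sub P).const_mul γ).fun_div ((hq.const_mul (1 - y)).add_const (y * P)) hN).congr_deriv ?_
  ring

/-! ## The transport -/

/-- **Registered stub `stub_saSwapTransport` (rung 10, X9): closed-form transport of the dlog
transposition for semialgebraic units.** For real functions `p, q`, `ℚ`-semialgebraic, positive and
continuous on `[0,1]`, differentiable on `(0,1)` with continuous `ℚ`-semialgebraic derivatives `p′, q′`,
and real algebraic `γ`, the relator `γ (p′(x₀)/p(x₀) − q′(x₁)/q(x₁))` equals, on `[0,1]⁴`, the sum of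
three fibrewise Stokes elements `Dⱼ − (Gⱼ|₁ − Gⱼ|₀)` in the directions `![2, 0, 1]` (primitives
`G₀ = γ (y p′/p + (1 − y) q′/q − (y p′ + (1 − y) q′)/N)`, `G₁ = G₂ = γ (p − q)/N`,
`N = (1 − y) q(x₁) + y p(x₀)`, `y = x₂`), minus the four boundary leftovers of `G₁, G₂` on the faces
`x₀ = 1, 0` and `x₁ = 1, 0` (in ratio form); all data `ℚ`-semialgebraic, continuous on the closed cube,
no kink set. [cite: KontsevichZagier2001, §1.2 rule (2)] -/
theorem stub_saSwapTransport :
    ∀ (γ : ℝ) (p q p' q' : ℝ → ℝ), IsAlgebraic ℚ γ →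
      IsSemialgebraicFunOn ℚ (Set.pi Set.univ (fun _ : Fin 1 => Set.Icc (0:ℝ) 1)) (fun z => p (z 0)) → IsSemialgebraicFunOn ℚ (Set.pi Set.univ (fun _ : Fin 1 => Set.Icc (0:ℝ) 1)) (fun z => q (z 0)) →
      IsSemialgebraicFunOn ℚ (Set.pi Set.univ (fun _ : Fin 1 => Set.Icc (0:ℝ) 1)) (fun z => p' (z 0)) → IsSemialgebraicFunOn ℚ (Set.pi Set.univ (fun _ : Fin 1 => Set.Icc (0:ℝ) 1)) (fun z => q' (z 0)) →
      ContinuousOn p (Set.Icc (0:ℝ) 1) → ContinuousOn q (Set.Icc (0:ℝ) 1) →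
      ContinuousOn p' (Set.Icc (0:ℝ) 1) → ContinuousOn q' (Set.Icc (0:ℝ) 1) →
      (∀ u ∈ Set.Ioo (0:ℝ) 1, HasDerivAt p (p' u) u) → (∀ u ∈ Set.Ioo (0:ℝ) 1, HasDerivAt q (q' u) u) →
      (∀ u ∈ Set.Icc (0:ℝ) 1, 0 < p u) → (∀ u ∈ Set.Icc (0:ℝ) 1, 0 < q u) →
      ∃ (G D : Fin 3 → (Fin 4 → ℝ) → ℝ) (r : Fin 3 → IntegralRep 4),
        (∀ j, IsSemialgebraicFunOn ℚ (Set.pi Set.univ (fun _ : Fin 4 => Set.Icc (0:ℝ) 1)) (G j) ∧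
          IsSemialgebraicFunOn ℚ (Set.pi Set.univ (fun _ : Fin 4 => Set.Icc (0:ℝ) 1)) (D j) ∧
          (∃ B : ℝ, ∀ x ∈ (Set.pi Set.univ (fun _ : Fin 4 => Set.Icc (0:ℝ) 1)), |(G j) x| ≤ B) ∧
          (∀ x ∈ (Set.pi Set.univ (fun _ : Fin 4 => Set.Icc (0:ℝ) 1)),
            ContinuousOn (fun s : ℝ => (G j) (Function.update x ((![2, 0, 1] : Fin 3 → Fin 4) j) s)) (Set.Icc (0:ℝ) 1)) ∧
          (∀ x ∈ (Set.pi Set.univ (fun _ : Fin 4 => Set.Icc (0:ℝ) 1)), x ((![2, 0, 1] : Fin 3 → Fin 4) j) ∈ Set.Ioo (0:ℝ) 1 →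
            HasDerivAt (fun s : ℝ => (G j) (Function.update x ((![2, 0, 1] : Fin 3 → Fin 4) j) s)) ((D j) x)
              (x ((![2, 0, 1] : Fin 3 → Fin 4) j)))) ∧
        (∀ j, (r j).domain = (Set.pi Set.univ (fun _ : Fin 4 => Set.Icc (0:ℝ) 1)) ∧
          ∀ x ∈ (Set.pi Set.univ (fun _ : Fin 4 => Set.Icc (0:ℝ) 1)), (r j).integrand x =
            D j x - (G j (Function.update x ((![2, 0, 1] : Fin 3 → Fin 4) j) 1) -
              G j (Function.update x ((![2, 0, 1] : Fin 3 → Fin 4) j) 0))) ∧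
        ∀ x ∈ (Set.pi Set.univ (fun _ : Fin 4 => Set.Icc (0:ℝ) 1)), ∑ j, (r j).integrand x =
          γ * (p' (x 0) / p (x 0) - q' (x 1) / q (x 1)) -
          γ * ((p 1 / q (x 1) - 1) / (1 + x 2 * (p 1 / q (x 1) - 1)) -
                (p 0 / q (x 1) - 1) / (1 + x 2 * (p 0 / q (x 1) - 1))) -
          γ * ((p (x 0) / q 1 - 1) / (1 + x 2 * (p (x 0) / q 1 - 1)) -
                (p (x 0) / q 0 - 1) / (1 + x 2 * (p (x 0) / q 0 - 1))) := by
  intro γ p q p' q' hγ hpsa hqsa hp'sa hq'sa hpc hqc hp'c hq'c hpd hqd hppos hqpos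
  -- the closed 4-cube and what holds on it
  set S : Set (Fin 4 → ℝ) := Set.pi Set.univ (fun _ : Fin 4 => Set.Icc (0:ℝ) 1) with hS
  have hSsa : IsSemialgebraic ℚ S := by rw [hS, ← cube_eq_pi]; exact isSemialgebraic_cube
  have hSc : IsCompact S := isCompact_univ_pi fun _ => isCompact_Icc
  have hmem : ∀ x ∈ S, ∀ i, x i ∈ Set.Icc (0:ℝ) 1 := fun x hx i => (Set.mem_univ_pi.mp hx) i
  have h0I : (0:ℝ) ∈ Set.Icc (0:ℝ) 1 := ⟨le_rfl, zero_le_one⟩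
  have h1I : (1:ℝ) ∈ Set.Icc (0:ℝ) 1 := ⟨zero_le_one, le_rfl⟩
  have h02 : (0 : Fin 4) ≠ 2 ∧ (1 : Fin 4) ≠ 2 := by decide
  have h10 : (1 : Fin 4) ≠ 0 ∧ (2 : Fin 4) ≠ 0 := by decide
  have h01 : (0 : Fin 4) ≠ 1 ∧ (2 : Fin 4) ≠ 1 := by decide
  -- moving one coordinate inside `[0,1]` stays in the cube
  have hupd : ∀ x ∈ S, ∀ (i : Fin 4), ∀ s ∈ Set.Icc (0:ℝ) 1, Function.update x i s ∈ S := by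
    intro x hx i s hs
    refine Set.mem_univ_pi.mpr fun l => ?_
    rcases eq_or_ne l i with rfl | hli
    · simpa using hs
    · rw [Function.update_of_ne hli]
      exact hmem x hx l
  -- positivity: `p(x₀), q(x₁) > 0` and the convex combinations `(1 - y) q(v) + y p(u) > 0`
  have hPne : ∀ x ∈ S, p (x 0) ≠ 0 := fun x hx => (hppos _ (hmem x hx 0)).ne'
  have hQne : ∀ x ∈ S, q (x 1) ≠ 0 := fun x hx => (hqpos _ (hmem x hx 1)).ne'
  have hWne : ∀ u ∈ Set.Icc (0:ℝ) 1, ∀ v ∈ Set.Icc (0:ℝ) 1, ∀ x ∈ S, (1 - x 2) * q v + x 2 * p u ≠ 0 :=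
    fun u hu v hv x hx => (swapTr_combo_pos (hppos u hu) (hqpos v hv) (hmem x hx 2)).ne'
  have hNne : ∀ x ∈ S, (1 - x 2) * q (x 1) + x 2 * p (x 0) ≠ 0 := fun x hx =>
    hWne _ (hmem x hx 0) _ (hmem x hx 1) x hx
  have hN2ne : ∀ x ∈ S, ((1 - x 2) * q (x 1) + x 2 * p (x 0)) ^ 2 ≠ 0 := fun x hx =>
    pow_ne_zero 2 (hNne x hx)
  -- the witnesses
  obtain ⟨G0, hG0⟩ : ∃ G0 : (Fin 4 → ℝ) → ℝ, G0 = fun x =>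
      γ * (x 2 * (p' (x 0) / p (x 0)) + (1 - x 2) * (q' (x 1) / q (x 1)) -
        (x 2 * p' (x 0) + (1 - x 2) * q' (x 1)) / ((1 - x 2) * q (x 1) + x 2 * p (x 0))) := ⟨_, rfl⟩
  obtain ⟨D0, hD0⟩ : ∃ D0 : (Fin 4 → ℝ) → ℝ, D0 = fun x =>
      γ * (p' (x 0) / p (x 0) - q' (x 1) / q (x 1) -
        (p' (x 0) * q (x 1) - q' (x 1) * p (x 0)) / ((1 - x 2) * q (x 1) + x 2 * p (x 0)) ^ 2) := ⟨_, rfl⟩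
  obtain ⟨G1, hG1⟩ : ∃ G1 : (Fin 4 → ℝ) → ℝ, G1 = fun x =>
      γ * (p (x 0) - q (x 1)) / ((1 - x 2) * q (x 1) + x 2 * p (x 0)) := ⟨_, rfl⟩
  obtain ⟨D1, hD1⟩ : ∃ D1 : (Fin 4 → ℝ) → ℝ, D1 = fun x =>
      γ * p' (x 0) * q (x 1) / ((1 - x 2) * q (x 1) + x 2 * p (x 0)) ^ 2 := ⟨_, rfl⟩
  obtain ⟨D2, hD2⟩ : ∃ D2 : (Fin 4 → ℝ) → ℝ, D2 = fun x =>
      -(γ * q' (x 1) * p (x 0)) / ((1 - x 2) * q (x 1) + x 2 * p (x 0)) ^ 2 := ⟨_, rfl⟩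
  -- boundary values: `G₀` vanishes on `y = 1` (`N = p(x₀)`) and on `y = 0` (`N = q(x₁)`)
  have hG0_one : ∀ x, G0 (Function.update x 2 1) = 0 := fun x => by
    simp only [hG0, Function.update_self, Function.update_of_ne h02.1, Function.update_of_ne h02.2]
    ring
  have hG0_zero : ∀ x, G0 (Function.update x 2 0) = 0 := fun x => by
    simp only [hG0, Function.update_self, Function.update_of_ne h02.1, Function.update_of_ne h02.2]
    ring
  -- boundary values of `G₁` on the faces `x₀ = c` and `x₁ = c`
  have hG1_x0 : ∀ c x, G1 (Function.update x 0 c) =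
      γ * (p c - q (x 1)) / ((1 - x 2) * q (x 1) + x 2 * p c) := fun c x => by
    simp only [hG1, Function.update_self, Function.update_of_ne h10.1, Function.update_of_ne h10.2]
  have hG1_x1 : ∀ c x, G1 (Function.update x 1 c) =
      γ * (p (x 0) - q c) / ((1 - x 2) * q c + x 2 * p (x 0)) := fun c x => by
    simp only [hG1, Function.update_self, Function.update_of_ne h01.1, Function.update_of_ne h01.2]
  -- atoms, semialgebraic and continuous on the cube (BCR Prop. 2.2.6; KZ §1.1 for the constants)
  have hy := angTrSC_apply hSsa 2
  have h1y := angTrSC_sub (angTrSC_const hSsa isAlgebraic_one) hy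
  have hγ' := angTrSC_const hSsa hγ
  have hP := saSwapTrSC_coord hpsa hpc (0 : Fin 4)
  have hQ := saSwapTrSC_coord hqsa hqc (1 : Fin 4)
  have hP' := saSwapTrSC_coord hp'sa hp'c (0 : Fin 4)
  have hQ' := saSwapTrSC_coord hq'sa hq'c (1 : Fin 4)
  have hN := angTrSC_add (angTrSC_mul h1y hQ) (angTrSC_mul hy hP)
  -- the transport quotient `γ (A - B)/((1 - y) B + y A)` for arbitrary atoms (so as to cover the faces)
  have hquot : ∀ {A B : (Fin 4 → ℝ) → ℝ},
      IsSemialgebraicFunOn ℚ S A ∧ ContinuousOn A S → IsSemialgebraicFunOn ℚ S B ∧ ContinuousOn B S →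
      (∀ x ∈ S, (1 - x 2) * B x + x 2 * A x ≠ 0) →
      IsSemialgebraicFunOn ℚ S (fun x => γ * (A x - B x) / ((1 - x 2) * B x + x 2 * A x)) ∧
        ContinuousOn (fun x => γ * (A x - B x) / ((1 - x 2) * B x + x 2 * A x)) S :=
    fun hA hB hne => angTrSC_div (angTrSC_mul hγ' (angTrSC_sub hA hB))
      (angTrSC_add (angTrSC_mul h1y hB) (angTrSC_mul hy hA)) hne
  -- regularity of the witnesses (closure under field operations, BCR Prop. 2.2.6)
  have hG0sc : IsSemialgebraicFunOn ℚ S G0 ∧ ContinuousOn G0 S := by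
    rw [hG0]
    exact angTrSC_mul hγ' (angTrSC_sub
      (angTrSC_add (angTrSC_mul hy (angTrSC_div hP' hP hPne)) (angTrSC_mul h1y (angTrSC_div hQ' hQ hQne)))
      (angTrSC_div (angTrSC_add (angTrSC_mul hy hP') (angTrSC_mul h1y hQ')) hN hNne))
  have hD0sc : IsSemialgebraicFunOn ℚ S D0 ∧ ContinuousOn D0 S := by
    rw [hD0]
    exact angTrSC_mul hγ' (angTrSC_sub (angTrSC_sub (angTrSC_div hP' hP hPne) (angTrSC_div hQ' hQ hQne))
      (angTrSC_div (angTrSC_sub (angTrSC_mul hP' hQ) (angTrSC_mul hQ' hP)) (angTrSC_pow hN 2) hN2ne))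
  have hG1sc : IsSemialgebraicFunOn ℚ S G1 ∧ ContinuousOn G1 S := by
    rw [hG1]
    exact hquot hP hQ hNne
  have hD1sc : IsSemialgebraicFunOn ℚ S D1 ∧ ContinuousOn D1 S := by
    rw [hD1]
    exact angTrSC_div (angTrSC_mul (angTrSC_mul hγ' hP') hQ) (angTrSC_pow hN 2) hN2ne
  have hD2sc : IsSemialgebraicFunOn ℚ S D2 ∧ ContinuousOn D2 S := by
    rw [hD2]
    exact angTrSC_div ⟨(angTrSC_mul (angTrSC_mul hγ' hQ') hP).1.fun_neg, (angTrSC_mul (angTrSC_mul hγ' hQ') hP).2.neg⟩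
      (angTrSC_pow hN 2) hN2ne
  have hI1sc : IsSemialgebraicFunOn ℚ S (fun x => D1 x - (G1 (Function.update x 0 1) - G1 (Function.update x 0 0))) ∧
      ContinuousOn (fun x => D1 x - (G1 (Function.update x 0 1) - G1 (Function.update x 0 0))) S := by
    simp only [hG1_x0]
    exact angTrSC_sub hD1sc (angTrSC_sub
      (hquot (saSwapTrSC_value hSsa hpsa h1I isAlgebraic_one) hQ fun x hx => hWne 1 h1I _ (hmem x hx 1) x hx)
      (hquot (saSwapTrSC_value hSsa hpsa h0I isAlgebraic_zero) hQ fun x hx => hWne 0 h0I _ (hmem x hx 1) x hx))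
  have hI2sc : IsSemialgebraicFunOn ℚ S (fun x => D2 x - (G1 (Function.update x 1 1) - G1 (Function.update x 1 0))) ∧
      ContinuousOn (fun x => D2 x - (G1 (Function.update x 1 1) - G1 (Function.update x 1 0))) S := by
    simp only [hG1_x1]
    exact angTrSC_sub hD2sc (angTrSC_sub
      (hquot hP (saSwapTrSC_value hSsa hqsa h1I isAlgebraic_one) fun x hx => hWne _ (hmem x hx 0) 1 h1I x hx)
      (hquot hP (saSwapTrSC_value hSsa hqsa h0I isAlgebraic_zero) fun x hx => hWne _ (hmem x hx 0) 0 h0I x hx))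
  -- packaged as `Fin 3`-families (`G₂ = G₁`); the integrands are `Dⱼ − (Gⱼ|₁ − Gⱼ|₀)` (`G₀|₁ = G₀|₀ = 0`)
  set G : Fin 3 → (Fin 4 → ℝ) → ℝ := ![G0, G1, G1]
  set D : Fin 3 → (Fin 4 → ℝ) → ℝ := ![D0, D1, D2]
  set I : Fin 3 → (Fin 4 → ℝ) → ℝ :=
    ![D0, fun x => D1 x - (G1 (Function.update x 0 1) - G1 (Function.update x 0 0)),
      fun x => D2 x - (G1 (Function.update x 1 1) - G1 (Function.update x 1 0))]
  have hGsc : ∀ j, IsSemialgebraicFunOn ℚ S (G j) ∧ ContinuousOn (G j) S := fun j => by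
    fin_cases j; exacts [hG0sc, hG1sc, hG1sc]
  have hDsa : ∀ j, IsSemialgebraicFunOn ℚ S (D j) := fun j => by
    fin_cases j; exacts [hD0sc.1, hD1sc.1, hD2sc.1]
  have hIsc : ∀ j, IsSemialgebraicFunOn ℚ S (I j) ∧ ContinuousOn (I j) S := fun j => by
    fin_cases j; exacts [hD0sc, hI1sc, hI2sc]
  -- continuity along closed fibres
  have hGfib : ∀ j, ∀ x ∈ S, ContinuousOn
      (fun s : ℝ => G j (Function.update x ((![2, 0, 1] : Fin 3 → Fin 4) j) s)) (Set.Icc (0:ℝ) 1) := by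
    intro j x hx
    have hc : Continuous fun s : ℝ => Function.update x ((![2, 0, 1] : Fin 3 → Fin 4) j) s :=
      continuous_const.update _ continuous_id
    exact (hGsc j).2.comp hc.continuousOn fun s hs => hupd x hx _ s hs
  -- derivatives along the fibres, at interior fibre points (quotient rule)
  have hGder : ∀ j, ∀ x ∈ S, x ((![2, 0, 1] : Fin 3 → Fin 4) j) ∈ Set.Ioo (0:ℝ) 1 →
      HasDerivAt (fun s : ℝ => G j (Function.update x ((![2, 0, 1] : Fin 3 → Fin 4) j) s)) (D j x)
        (x ((![2, 0, 1] : Fin 3 → Fin 4) j)) := by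
    intro j
    fin_cases j
    · -- element `0`, along `y = x 2`
      intro x hx _
      show HasDerivAt (fun s : ℝ => G0 (Function.update x 2 s)) (D0 x) (x 2)
      have hfun : ∀ s, G0 (Function.update x 2 s) =
          γ * (s * (p' (x 0) / p (x 0)) + (1 - s) * (q' (x 1) / q (x 1)) -
            (s * p' (x 0) + (1 - s) * q' (x 1)) / ((1 - s) * q (x 1) + s * p (x 0))) := fun s => by
        simp only [hG0, Function.update_self, Function.update_of_ne h02.1, Function.update_of_ne h02.2]
      simp only [hfun, hD0]
      exact swapTr_hasDerivAt_dir2 (hNne x hx)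
    · -- element `1`, along `x 0`
      intro x hx hx0
      show HasDerivAt (fun s : ℝ => G1 (Function.update x 0 s)) (D1 x) (x 0)
      simp only [hG1_x0, hD1]
      exact saSwapTr_hasDerivAt_dir0 (hpd (x 0) hx0) (hNne x hx)
    · -- element `2` (`G₂ = G₁`), along `x 1`
      intro x hx hx1
      show HasDerivAt (fun s : ℝ => G1 (Function.update x 1 s)) (D2 x) (x 1)
      simp only [hG1_x1, hD2]
      exact saSwapTr_hasDerivAt_dir1 (hqd (x 1) hx1) (hNne x hx)
  -- the three closed-cube representations
  let r : Fin 3 → IntegralRep 4 := fun j =>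
    { domain := S
      integrand := I j
      isSemialgebraic_domain := hSsa
      isSemialgebraicFunOn_integrand := (hIsc j).1
      integrableOn := (hIsc j).2.integrableOn_compact hSc }
  refine ⟨G, D, r, fun j => ⟨(hGsc j).1, hDsa j, angTrSC_bound (hGsc j) hSc, hGfib j, hGder j⟩,
    ?_, fun x hx => ?_⟩
  · -- the integrand clauses
    intro j
    fin_cases j <;> refine ⟨rfl, fun x _ => ?_⟩
    · show D0 x = D0 x - (G0 (Function.update x 2 1) - G0 (Function.update x 2 0))
      rw [hG0_one, hG0_zero, sub_zero, sub_zero]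
    · rfl
    · rfl
  · -- `Σ integrands = γ (p′/p − q′/q) − leftovers`: `D₀ + D₁ + D₂ = γ (p′/p − q′/q)`, and the
    -- leftovers in ratio form
    rw [Fin.sum_univ_three, swapTr_ratio (x 2) (hQne x hx), swapTr_ratio (x 2) (hQne x hx),
      swapTr_ratio (x 2) (hqpos 1 h1I).ne', swapTr_ratio (x 2) (hqpos 0 h0I).ne']
    show D0 x + (D1 x - (G1 (Function.update x 0 1) - G1 (Function.update x 0 0))) +
      (D2 x - (G1 (Function.update x 1 1) - G1 (Function.update x 1 0))) = _
    simp only [hD0, hD1, hD2, hG1_x0, hG1_x1]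
    ring

end Summit.KontsevichZagierPeriods.KontsevichZagierPeriods.Cruxes.StokesGeneration.FibrewiseStokes
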